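import Summits.QuantumFields.BalabanUV.T4Continuum.Spine.NE1p.DressedTransportAssembledUniformSliceWin
import Summits.QuantumFields.BalabanUV.T4Continuum.Spine.NE1p.DressedStabilityOfWinSchedules

/-!
# T⁴ programme, spine estimate NE1′ (node O3b/H2) — THE ALL-CUTOFF FACE OVER THE ASSEMBLED LEAF WITH CUTOFF-FREE WINDOWS:
# `DressedStability 𝒯` (ROOT-C) and `DressedBudget 𝒯 wt` (ROOT-B) FROM THE DISPLAYED ESTIMATE BINDERS AT EVERY `(p, K)`, ONE SET OF
# K-∕μ-FREE SCALARS, RATIO-BOUNDED `WindowScheduleModWin` SCHEDULES (swarm item S3h «assembled slice-win face», part 2;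
# INTENT CLAIMS.log l.9922 — the «END-ALL-slice-win» of typer ruling R-T35 (i))

Cell `pub-balaban`, sub-cell `t4`, BINDER-OWNERS row NE1′, formalisation crew `b2b-balaban-t4-ne1p-formalise-*`, seat `…-leaf-09`
(gen 2).  ADDITIVE — imports `Spine/NE1p/DressedTransportAssembledUniformSliceWin` (S3h part 1: `bookingLeaves_assembled_swin_of_schedule`,
`geometric_mod_ratio_κ`; through it leaf-04's row S1e and rows S3∕S3g) and this seat's `Spine/NE1p/DressedStabilityOfWinSchedules` (S3g part 2, p213964: the ROOT-B hand-off
`dressedBudget_win_of_cell` over the SAME constants, reused BY NAME; through it `DressedRootFam`'s `DressedBudget`) ONLY; modifies nothing.  Siblings: S3e `DressedStabilityOfRatioSchedules` (leaf-02; RATIO face, `hP` assembled, `WindowSchedule`,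
K-linear window budget) and S3g `DressedStabilityOfWinSchedules` (WINDOW face, `hP` displayed); THIS = `hP` assembled AND cutoff-free windows.

WHAT THIS FILE DOES.  END-B consumes ONE `U : UniformConstants` and a bundle at EVERY `(p, K)`; part 1 builds that bundle over
`U := uniformConstantsCell L (4c_δ∕r) c̄ κ N₀ A₀ m s̄⁰ ρ′ …` from one cutoff's displayed binders.  Here every binder is a `(p, K)`-FAMILY
— one schedule `W p K : WindowScheduleModWin r (w p K)`, the assembled END's estimate ∕ dictionary family, the booking-level walls and
the ratio family — while the TWELVE SCALARS `κ L c̄ N₀ A₀ s̄⁰ ρ′ r c_δ m` (+ signs, (w7) `hloc`, (w6) `hsmall`) are bound ONCE, BEFORE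
`p` and `K` (RULING R-t4r2-Q2, caveat k1: that order IS the content).
* §1 **`dressedStabilityWith_swin_of_schedules … : DressedStabilityWith 𝒯 A₀ (rhoOne L⁻² (4c_δ∕r) c̄ κ) L⁻³`** (constants displayed;
  sign `hκ`) and **`dressedStability_swin_of_schedules … : DressedStability 𝒯`** (THE ROW ROOT literally; `hκ` read off `hratio`).
* §2 **`dressedBudget_swin_of_schedules … : DressedBudget 𝒯 wt`** — ROOT-B from the SAME displayed families + K-free positional
  counts `N₀·(L⁴)^{k−j}` + weights `0 ≤ wt ≤ w̄` (§1's With-form, then S3g's `dressedBudget_win_of_cell` BY NAME; `c_B = w̄·N₀A₀∕(1−ρ′)`).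
* §3 `hratio_geometric_mod_all`: the SINGLE cutoff-free schedule `W p K := WindowScheduleModWin.geometric r w q σ₀ ϱ₀ ρ∞` inhabits the
  ratio family with `κ := 2σ₀∕(ϱ₀q)` for all `(p, K, k)` — ONE schedule for every cutoff, the (w1) window `bondBall d (ρw k′)` in `hsl`
  the same finite ball `⊆ bondBall d (ρ∞ + ((1+2q)σ₀+ϱ₀)∕(1−q))` at EVERY cutoff (part 1 `geometric_mod_birthWindow_ratio`).

WHAT IS CLOSED AT THE TYPED LEVEL, WHAT IS NOT (k1).  LF-1 = F-ne1pleaf08-1 ((3) floor, (4) uniform chart window) and LF-2 =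
F-ne1pleaf04-1 (uniform slice window in `hN2cx`∕`hpairx`∕`hP`) are CLOSED for the assembled leaf by leaf-04's S1e (birth window
`ρ∞ + ((1+2q)σ₀+ϱ₀)∕(1−q)` of `WindowScheduleModWin.geometric`, p213785 ∕ p214439): no typed object here forces a cutoff-dependent
constant.  What remains displayed is EXACTLY the wall — (w1) `hsl`, (w2-act) `hB`∕`hE` (+ THE NUMBER via (w6)), (w4)'s constant inside
(w7)'s `locCell … ≤ ρ′ < 1`, (I4′) `hδf`∕`hδfwk`∕`hpairx`∕`hrate` + `hcm` (F-6's rate ψ = L⁻², k3; absolute-step guards, X(S1d)∕X40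
INFO-2), (w5) `hreg`, (w3-book) `hcount`, (w1)+(w5b) `hbirth` — as `(p,K)`-families at FIXED scalars; whether Bałaban's densities
inhabit them IS NE1′'s estimate content, displayed, not decided; 0 of them instantiated here.

HONEST FRAMING.  Kernel composition over hypothesis shapes ([folklore]; 0 sorry; 0 citations used as facts; no `def … : Prop`, no
structure naming a wall).  Headline (c4): «NE1′ (all cutoffs, all run parameters) ⇐ the DISPLAYED estimate binders ∀ (p,K) + located
largeness∕window + ratio-bounded `WindowScheduleModWin` schedules (ONE cutoff-free schedule admissible; no `hP`, no floor, no uniform-w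
budget); NOT proved; 0 binders instantiated on Bałaban's densities»; printed loci ([Balaban1989LargeFieldII] (1.65) p. 375, (1.71)–(1.75)
pp. 379–380) are TYPE only; spine PROVED 0∕9.  Rung (B)+1 on ONE finite four-torus — NOT infinite volume, NOT a mass gap, NOT OS on
ℝ⁴, NOT Clay.  HONEST DEPENDENCY: continuum YM on T⁴ ⇐ BetaPertH ∧ nine spine estimates (0/9 proved); BetaPertH ⇐ (D1) ∧ (D4) ∧
CAP+tail; G-an2-4 gates asym, D1 and NE2/3/4.
-/

noncomputable section

namespace Summit.QuantumFields.BalabanUV.T4Continuum.NE1p.DressedStabilityOfSliceWinSchedules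

open MeasureTheory Set Metric Finset
open scoped BigOperators
open Literature.MathematicalPhysics.QuantumFieldTheory.Balaban1983to89
open Literature.MathematicalPhysics.QuantumFieldTheory.Balaban1983to89.T4TermFormat
open Literature.MathematicalPhysics.QuantumFieldTheory.Balaban1983to89.T4GatedBooking
open Literature.MathematicalPhysics.QuantumFieldTheory.Balaban1983to89.T4TrajectoryComparison
open Literature.MathematicalPhysics.QuantumFieldTheory.Balaban1983to89.T4TrajectoryModulus
open T4BirthChartTransport (GaugeInvariant BirthSlice RelGauge)
open T4BlockTransport (Fld NDir latMove latN)
open T4TrajectoryDensity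
open Summit.QuantumFields.BalabanUV.T4Continuum.T4TrajectoryDensityDressed
open Summit.QuantumFields.BalabanUV.T4Continuum.NE1p.DressedRoot
open Summit.QuantumFields.BalabanUV.T4Continuum.NE1p.DressedWindowScheduleWin
open Summit.QuantumFields.BalabanUV.T4Continuum.NE1p.DressedWindowScheduleModWin
open Summit.QuantumFields.BalabanUV.T4Continuum.NE1p.DressedUniformConstants
open Summit.QuantumFields.BalabanUV.T4Continuum.NE1p.DressedTransportUniformWin
open Summit.QuantumFields.BalabanUV.T4Continuum.NE1p.DressedTransportAssembledUniformSliceWin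
open Summit.QuantumFields.BalabanUV.T4Continuum.NE1p.DressedStabilityOfWinSchedules

/-! ## §1 The all-cutoff face: END-B over the assembled slice-window bundles, scalars first -/

section AllCutoffs

variable {P : Type*} (𝒯 : DressedTower P)
variable {R : Type*} [NormedRing R] [NormedAlgebra ℂ R] [MeasurableSpace R] {d : ℕ}

/-- **THE ROW ROOT WITH ITS CONSTANTS DISPLAYED, FROM THE DISPLAYED FAMILIES — ASSEMBLED SLICE-WINDOW FACE** [bookkeeping]: the
twelve K-∕μ-free scalars of row S3 bound ONCE; then for EVERY run parameter `p` and cutoff `K` a schedule `W p K : WindowScheduleModWin`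
with ratio `2σ ≤ κ·ϱc` and the displayed binder families of part 1's `bookingLeaves_assembled_swin_of_schedule` over `𝒯.B p K` ∕
`𝒯.T p K` — give `DressedStabilityWith 𝒯 A₀ (rhoOne L⁻² (4c_δ∕r) c̄ κ) L⁻³` by END-B `dressedStabilityWith_of_bookingLeaves` BY NAME over
the ONE `uniformConstantsCell …`.  The order `∃ scalars, ∀ p K` is the content; nothing of Bałaban's densities is asserted. [folklore] -/
theorem dressedStabilityWith_swin_of_schedules {κ L cbar N₀ A₀ sbar ρ' r cδ m : ℝ} {w : P → ℕ → ℝ}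
    (W : ∀ p K, WindowScheduleModWin r (w p K))
    {Fn : ∀ p K, (𝒯.B p K).Birth → ℕ → ℕ → Fld d R → ℂ}
    {rel : ∀ p K, (𝒯.B p K).Birth → ℕ → ℕ → Fld d R → Fld d R → Prop}
    {ref : ∀ p K, (𝒯.B p K).Birth → ℕ → Fld d R → Fld d R} {base : ∀ p K, (𝒯.B p K).Birth → ℕ → Fld d R → ℝ}
    {𝒜 𝒬 : ∀ p K, (𝒯.B p K).Birth → ℕ → Fld d R → Fld d R → ℂ} {q : ∀ p K, (𝒯.B p K).Birth → ℕ → Fld d R → ℂ}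
    {μ : ∀ p K, (𝒯.B p K).Birth → ℕ → Measure (Fld d R)} {z₀ z₁ : ∀ p K, (𝒯.B p K).Birth → ℕ → Fld d R}
    {defect : ∀ p K, (𝒯.B p K).Birth → ℕ → ℕ → ℝ} {s s1 : ∀ p K, (𝒯.B p K).Birth → ℕ → ℝ}
    {Asz : ∀ p K, (𝒯.B p K).Birth → ℕ → ℕ → ℝ} {S : ∀ p K, ℕ → (𝒯.B p K).Birth → Finset (𝒯.B p K).Birth}
    {Sg : ∀ p K, ℕ → (𝒯.B p K).Birth → Finset ((𝒯.B p K).Birth × ℕ)} {c : ∀ p K, (𝒯.B p K).Birth → ℕ → ℂ}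
    {δf : ∀ p K, (𝒯.B p K).Birth → ℕ → (𝒯.B p K).Birth × ℕ → ℝ} {creg : P → ℕ → ℕ → ℝ}
    -- the ratio family (K-free κ)
    (hratio : ∀ p K k, 2 * (W p K).σ k ≤ κ * (W p K).ϱc k)
    -- the twelve scalars' signs and row S3's located inequalities — ONCE
    (hL : 1 ≤ L) (hcbar : 0 ≤ cbar) (hκ : 0 ≤ κ) (hN₀ : 0 ≤ N₀) (hA₀ : 0 ≤ A₀) (hm : 0 ≤ m)
    (hloc : locCell L (4 * cδ / r) cbar κ ≤ ρ') (hρ'1 : ρ' < 1)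
    (hsmall : m * (N₀ * A₀ * (1 - ρ')⁻¹) ≤ 1 - sbar) (hr : 0 < r) (hcδ : 0 ≤ cδ)
    -- the assembled END's estimate ∕ dictionary families
    (hsl : ∀ p K, ∀ (b : (𝒯.B p K).Birth) (k' : ℕ), (𝒯.B p K).birthScale b ≤ k' → k' ≤ (𝒯.B p K).K →
      RanBelow (budgetGate (𝒯.T p K) (s p K) m (S p K) (4 * cδ / r)
        (fun i => (L ^ 2)⁻¹ * (fun _ : ℕ => alphaCell κ) i)) k' →
      BirthSlice (Fn p K b k' k') latMove latN (bondBall d ((W p K).ρw k') : Set (Fld d R)) ((W p K).wc k') r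
        ((𝒯.T p K).gen b k'))
    (hFn : ∀ p K, ∀ (b : (𝒯.B p K).Birth) (k' k : ℕ), (𝒯.B p K).birthScale b ≤ k' → k' ≤ k → k + 1 ≤ (𝒯.B p K).K →
      RanBelow (budgetGate (𝒯.T p K) (s p K) m (S p K) (4 * cδ / r)
        (fun i => (L ^ 2)⁻¹ * (fun _ : ℕ => alphaCell κ) i)) (k + 1) →
      ∀ U, Fn p K b k' (k + 1) U =
        wOp (expWeight (base p K b k) (𝒜 p K b k + 𝒬 p K b k)) (μ p K b k) (z₀ p K b k) U
          (fun z => Fn p K b k' k (U + z)))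
    (h𝒢 : ∀ p K, ∀ (b : (𝒯.B p K).Birth) (k' k : ℕ), (𝒯.B p K).birthScale b ≤ k' → k' ≤ k → k + 1 ≤ (𝒯.B p K).K →
      RanBelow (budgetGate (𝒯.T p K) (s p K) m (S p K) (4 * cδ / r)
        (fun i => (L ^ 2)⁻¹ * (fun _ : ℕ => alphaCell κ) i)) (k + 1) →
      ∀ U, (fun z => Fn p K b k' k (U + z)) ∈ BddClass ℂ (μ p K b k))
    (hB : ∀ p K, ∀ (b : (𝒯.B p K).Birth) (k' k : ℕ), (𝒯.B p K).birthScale b ≤ k' → k' ≤ k → k + 1 ≤ (𝒯.B p K).K →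
      RanBelow (budgetGate (𝒯.T p K) (s p K) m (S p K) (4 * cδ / r)
        (fun i => (L ^ 2)⁻¹ * (fun _ : ℕ => alphaCell κ) i)) (k + 1) →
      RealBaseAt (ref p K b k) (base p K b k) (𝒜 p K b k) (μ p K b k)
        (bondBall d ((W p K).ρw (k + 1)) : Set (Fld d R)))
    (hE : ∀ p K, ∀ (b : (𝒯.B p K).Birth) (k' k : ℕ), (𝒯.B p K).birthScale b ≤ k' → k' ≤ k → k + 1 ≤ (𝒯.B p K).K →
      RanBelow (budgetGate (𝒯.T p K) (s p K) m (S p K) (4 * cδ / r)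
        (fun i => (L ^ 2)⁻¹ * (fun _ : ℕ => alphaCell κ) i)) (k + 1) →
      ExponentSliceAt (ref p K b k) (𝒜 p K b k) (μ p K b k) latMove latN
        (bondBall d ((W p K).ρw (k + 1)) : Set (Fld d R)) ((W p K).wc (k + 1)) ((W p K).ϱc k) (s p K b k))
    (hQ : ∀ p K, ∀ b k, (fun U z => 𝒬 p K b k U z - q p K b k U) =
      fun U z => c p K b k * ∑ x ∈ Sg p K k b, (Fn p K x.1 x.2 k (U + z) - Fn p K x.1 x.2 k (U + z₁ p K b k)))
    (hSg : ∀ p K, ∀ k b, ∀ x ∈ Sg p K k b, x.1 ∈ S p K k b ∧ (𝒯.B p K).birthScale x.1 ≤ x.2 ∧ x.2 ≤ k)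
    (hs1 : ∀ p K, ∀ b k, s1 p K b k = ‖c p K b k‖ * ∑ x ∈ Sg p K k b,
      (4 / r * stepProd (fun _ : ℕ => alphaCell κ) x.2 k * (𝒯.T p K).gen x.1 x.2) * δf p K b k x)
    (hAsz_birth : ∀ p K, ∀ f k'', Asz p K f k'' k'' = (𝒯.T p K).gen f k'')
    (hAsz_step : ∀ p K, ∀ f k'' k, (𝒯.B p K).birthScale f ≤ k'' → k'' ≤ k →
      Asz p K f k'' (k + 1) = Real.exp (3 * (s p K f k + s1 p K f k)) * Asz p K f k'' k)
    (hcm : ∀ p K, ∀ b k, ‖c p K b k‖ ≤ m)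
    (hδf : ∀ p K, ∀ b k, ∀ x ∈ Sg p K k b, 0 ≤ δf p K b k x ∧ δf p K b k x ≤ cδ * ((L ^ 2)⁻¹) ^ (k - x.2))
    (hδfwk : ∀ p K, ∀ b k, ∀ x ∈ Sg p K k b, δf p K b k x ≤ (W p K).wc k)
    (hDμ : ∀ p K, ∀ b k, ∀ᵐ z ∂μ p K b k, z ∈ (bondBall d ((W p K).σ k) : Set (Fld d R)))
    (hz₁ : ∀ p K, ∀ b k, z₁ p K b k ∈ (bondBall d ((W p K).σ k) : Set (Fld d R)))
    (hpairx : ∀ p K, ∀ (b : (𝒯.B p K).Birth) (k' k : ℕ), (𝒯.B p K).birthScale b ≤ k' → k' ≤ k →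
      ∀ x ∈ Sg p K k b, ∀ U₀ ∈ (bondBall d ((W p K).ρw (k + 1)) : Set (Fld d R)), ∀ pd : NDir d R, 0 < latN pd →
        latN pd ≤ (W p K).wc (k + 1) →
        ∀ᵐ z ∂μ p K b k, ∀ t ∈ tube ((W p K).ϱ₁ k / latN pd),
          RelGauge (rel p K x.1 x.2 k) latMove latN (latMove U₀ pd t + z₁ p K b k) (latMove U₀ pd t + z) (δf p K b k x))
    (hinv : ∀ p K, ∀ b k' k, GaugeInvariant (rel p K b k' k) (Fn p K b k' k))
    (hmeas : ∀ p K, ∀ (b f : (𝒯.B p K).Birth) (k'' k : ℕ) (U : Fld d R),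
      AEStronglyMeasurable (fun z => Fn p K f k'' k (U + z)) (μ p K b k))
    (hdefwk : ∀ p K, ∀ (b : (𝒯.B p K).Birth) (k' k : ℕ), defect p K b k' k ≤ (W p K).wc k)
    (hrate : ∀ p K, ∀ (b : (𝒯.B p K).Birth) (k' k : ℕ), (𝒯.B p K).birthScale b ≤ k' → k' ≤ k → k ≤ (𝒯.B p K).K →
      defect p K b k' k ≤ cδ * ((L ^ 2)⁻¹) ^ (k - k'))
    (hlin : ∀ p K, ∀ (b : (𝒯.B p K).Birth) (k' k : ℕ), (𝒯.B p K).birthScale b ≤ k' → k' ≤ k → k ≤ (𝒯.B p K).K →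
      RanBelow (budgetGate (𝒯.T p K) (s p K) m (S p K) (4 * cδ / r)
        (fun i => (L ^ 2)⁻¹ * (fun _ : ℕ => alphaCell κ) i)) k →
      ∀ ε > 0, ∃ U₀ ∈ (bondBall d ((W p K).ρw k) : Set (Fld d R)), ∃ U₁ : Fld d R,
        RelGauge (rel p K b k' k) latMove latN U₀ U₁ (defect p K b k' k) ∧
        (𝒯.T p K).lin b k' k ≤ ‖Fn p K b k' k U₁ - Fn p K b k' k U₀‖ + ε)
    -- the booking-level wall families
    (hc0 : ∀ p K k, 0 ≤ creg p K k) (hcb : ∀ p K k, k < (𝒯.B p K).K → creg p K k ≤ cbar)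
    (hreg : ∀ p K, (𝒯.T p K).RegeneratesFromVar (creg p K)
      (budgetGate (𝒯.T p K) (s p K) m (S p K) (4 * cδ / r) (fun _ : ℕ => (L ^ 2)⁻¹ * alphaCell κ)))
    (hs₀ : ∀ p K, ∀ b k, s p K b k ≤ sbar)
    (hS : ∀ p K, ∀ k b, ∀ f ∈ S p K k b, (𝒯.B p K).birthScale f ≤ k)
    (hcount : ∀ p K, ∀ k b, ∀ j ≤ k,
      (((S p K k b).filter fun f => (𝒯.B p K).birthScale f = j).card : ℝ) ≤ N₀ * (L ^ 4) ^ (k - j))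
    (hbirth : ∀ p K, (𝒯.T p K).BirthsFromOld (4 * cδ / r) (fun _ : ℕ => (L ^ 2)⁻¹ * alphaCell κ)
      (twoRate A₀ (rhoOne (L ^ 2)⁻¹ (4 * cδ / r) cbar κ) (L⁻¹ ^ 3) (𝒯.B p K).K)
      (budgetGate (𝒯.T p K) (s p K) m (S p K) (4 * cδ / r) (fun _ : ℕ => (L ^ 2)⁻¹ * alphaCell κ))) :
    DressedStabilityWith 𝒯 A₀ (rhoOne (L ^ 2)⁻¹ (4 * cδ / r) cbar κ) (L⁻¹ ^ 3) :=
  dressedStabilityWith_of_bookingLeaves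
    (uniformConstantsCell L (4 * cδ / r) cbar κ N₀ A₀ m sbar ρ' hL (div_nonneg (mul_nonneg (by norm_num) hcδ) hr.le) hcbar
      hκ hN₀ hA₀ hm hloc hρ'1 hsmall)
    𝒯 fun p K =>
      bookingLeaves_assembled_swin_of_schedule (W p K) (hratio p K) hL hcbar hN₀ hA₀ hm hloc hρ'1 hsmall hr hcδ (hsl p K)
        (hFn p K) (h𝒢 p K) (hB p K) (hE p K) (hQ p K) (hSg p K) (hs1 p K) (hAsz_birth p K) (hAsz_step p K) (hcm p K)
        (hδf p K) (hδfwk p K) (hDμ p K) (hz₁ p K) (hpairx p K) (hinv p K) (hmeas p K) (hdefwk p K) (hrate p K) (hlin p K)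
        (hc0 p K) (hcb p K) (hreg p K) (hs₀ p K) (hS p K) (hcount p K) (hbirth p K)

/-- **THE ROW ROOT — `DressedStability 𝒯` — FROM THE DISPLAYED ESTIMATE FAMILIES, ASSEMBLED SLICE-WINDOW FACE** [bookkeeping]:
as `dressedStabilityWith_swin_of_schedules`, conclusion LITERALLY `DressedRoot.DressedStability 𝒯`; the sign `0 ≤ κ` is read off the
ratio family at any `(p, 0)` (empty parameter type: the root holds with zero constants).  «NE1′ (all cutoffs, all run parameters) ⇐
the displayed estimate binders ∀ (p,K) + located largeness + ratio-bounded cutoff-free-window schedules»; NOT proved; nothing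
instantiated on Bałaban's densities. [folklore] -/
theorem dressedStability_swin_of_schedules {κ L cbar N₀ A₀ sbar ρ' r cδ m : ℝ} {w : P → ℕ → ℝ}
    (W : ∀ p K, WindowScheduleModWin r (w p K))
    {Fn : ∀ p K, (𝒯.B p K).Birth → ℕ → ℕ → Fld d R → ℂ}
    {rel : ∀ p K, (𝒯.B p K).Birth → ℕ → ℕ → Fld d R → Fld d R → Prop}
    {ref : ∀ p K, (𝒯.B p K).Birth → ℕ → Fld d R → Fld d R} {base : ∀ p K, (𝒯.B p K).Birth → ℕ → Fld d R → ℝ}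
    {𝒜 𝒬 : ∀ p K, (𝒯.B p K).Birth → ℕ → Fld d R → Fld d R → ℂ} {q : ∀ p K, (𝒯.B p K).Birth → ℕ → Fld d R → ℂ}
    {μ : ∀ p K, (𝒯.B p K).Birth → ℕ → Measure (Fld d R)} {z₀ z₁ : ∀ p K, (𝒯.B p K).Birth → ℕ → Fld d R}
    {defect : ∀ p K, (𝒯.B p K).Birth → ℕ → ℕ → ℝ} {s s1 : ∀ p K, (𝒯.B p K).Birth → ℕ → ℝ}
    {Asz : ∀ p K, (𝒯.B p K).Birth → ℕ → ℕ → ℝ} {S : ∀ p K, ℕ → (𝒯.B p K).Birth → Finset (𝒯.B p K).Birth}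
    {Sg : ∀ p K, ℕ → (𝒯.B p K).Birth → Finset ((𝒯.B p K).Birth × ℕ)} {c : ∀ p K, (𝒯.B p K).Birth → ℕ → ℂ}
    {δf : ∀ p K, (𝒯.B p K).Birth → ℕ → (𝒯.B p K).Birth × ℕ → ℝ} {creg : P → ℕ → ℕ → ℝ}
    (hratio : ∀ p K k, 2 * (W p K).σ k ≤ κ * (W p K).ϱc k)
    (hL : 1 ≤ L) (hcbar : 0 ≤ cbar) (hN₀ : 0 ≤ N₀) (hA₀ : 0 ≤ A₀) (hm : 0 ≤ m)
    (hloc : locCell L (4 * cδ / r) cbar κ ≤ ρ') (hρ'1 : ρ' < 1)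
    (hsmall : m * (N₀ * A₀ * (1 - ρ')⁻¹) ≤ 1 - sbar) (hr : 0 < r) (hcδ : 0 ≤ cδ)
    (hsl : ∀ p K, ∀ (b : (𝒯.B p K).Birth) (k' : ℕ), (𝒯.B p K).birthScale b ≤ k' → k' ≤ (𝒯.B p K).K →
      RanBelow (budgetGate (𝒯.T p K) (s p K) m (S p K) (4 * cδ / r)
        (fun i => (L ^ 2)⁻¹ * (fun _ : ℕ => alphaCell κ) i)) k' →
      BirthSlice (Fn p K b k' k') latMove latN (bondBall d ((W p K).ρw k') : Set (Fld d R)) ((W p K).wc k') r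
        ((𝒯.T p K).gen b k'))
    (hFn : ∀ p K, ∀ (b : (𝒯.B p K).Birth) (k' k : ℕ), (𝒯.B p K).birthScale b ≤ k' → k' ≤ k → k + 1 ≤ (𝒯.B p K).K →
      RanBelow (budgetGate (𝒯.T p K) (s p K) m (S p K) (4 * cδ / r)
        (fun i => (L ^ 2)⁻¹ * (fun _ : ℕ => alphaCell κ) i)) (k + 1) →
      ∀ U, Fn p K b k' (k + 1) U =
        wOp (expWeight (base p K b k) (𝒜 p K b k + 𝒬 p K b k)) (μ p K b k) (z₀ p K b k) U
          (fun z => Fn p K b k' k (U + z)))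
    (h𝒢 : ∀ p K, ∀ (b : (𝒯.B p K).Birth) (k' k : ℕ), (𝒯.B p K).birthScale b ≤ k' → k' ≤ k → k + 1 ≤ (𝒯.B p K).K →
      RanBelow (budgetGate (𝒯.T p K) (s p K) m (S p K) (4 * cδ / r)
        (fun i => (L ^ 2)⁻¹ * (fun _ : ℕ => alphaCell κ) i)) (k + 1) →
      ∀ U, (fun z => Fn p K b k' k (U + z)) ∈ BddClass ℂ (μ p K b k))
    (hB : ∀ p K, ∀ (b : (𝒯.B p K).Birth) (k' k : ℕ), (𝒯.B p K).birthScale b ≤ k' → k' ≤ k → k + 1 ≤ (𝒯.B p K).K →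
      RanBelow (budgetGate (𝒯.T p K) (s p K) m (S p K) (4 * cδ / r)
        (fun i => (L ^ 2)⁻¹ * (fun _ : ℕ => alphaCell κ) i)) (k + 1) →
      RealBaseAt (ref p K b k) (base p K b k) (𝒜 p K b k) (μ p K b k)
        (bondBall d ((W p K).ρw (k + 1)) : Set (Fld d R)))
    (hE : ∀ p K, ∀ (b : (𝒯.B p K).Birth) (k' k : ℕ), (𝒯.B p K).birthScale b ≤ k' → k' ≤ k → k + 1 ≤ (𝒯.B p K).K →
      RanBelow (budgetGate (𝒯.T p K) (s p K) m (S p K) (4 * cδ / r)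
        (fun i => (L ^ 2)⁻¹ * (fun _ : ℕ => alphaCell κ) i)) (k + 1) →
      ExponentSliceAt (ref p K b k) (𝒜 p K b k) (μ p K b k) latMove latN
        (bondBall d ((W p K).ρw (k + 1)) : Set (Fld d R)) ((W p K).wc (k + 1)) ((W p K).ϱc k) (s p K b k))
    (hQ : ∀ p K, ∀ b k, (fun U z => 𝒬 p K b k U z - q p K b k U) =
      fun U z => c p K b k * ∑ x ∈ Sg p K k b, (Fn p K x.1 x.2 k (U + z) - Fn p K x.1 x.2 k (U + z₁ p K b k)))
    (hSg : ∀ p K, ∀ k b, ∀ x ∈ Sg p K k b, x.1 ∈ S p K k b ∧ (𝒯.B p K).birthScale x.1 ≤ x.2 ∧ x.2 ≤ k)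
    (hs1 : ∀ p K, ∀ b k, s1 p K b k = ‖c p K b k‖ * ∑ x ∈ Sg p K k b,
      (4 / r * stepProd (fun _ : ℕ => alphaCell κ) x.2 k * (𝒯.T p K).gen x.1 x.2) * δf p K b k x)
    (hAsz_birth : ∀ p K, ∀ f k'', Asz p K f k'' k'' = (𝒯.T p K).gen f k'')
    (hAsz_step : ∀ p K, ∀ f k'' k, (𝒯.B p K).birthScale f ≤ k'' → k'' ≤ k →
      Asz p K f k'' (k + 1) = Real.exp (3 * (s p K f k + s1 p K f k)) * Asz p K f k'' k)
    (hcm : ∀ p K, ∀ b k, ‖c p K b k‖ ≤ m)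
    (hδf : ∀ p K, ∀ b k, ∀ x ∈ Sg p K k b, 0 ≤ δf p K b k x ∧ δf p K b k x ≤ cδ * ((L ^ 2)⁻¹) ^ (k - x.2))
    (hδfwk : ∀ p K, ∀ b k, ∀ x ∈ Sg p K k b, δf p K b k x ≤ (W p K).wc k)
    (hDμ : ∀ p K, ∀ b k, ∀ᵐ z ∂μ p K b k, z ∈ (bondBall d ((W p K).σ k) : Set (Fld d R)))
    (hz₁ : ∀ p K, ∀ b k, z₁ p K b k ∈ (bondBall d ((W p K).σ k) : Set (Fld d R)))
    (hpairx : ∀ p K, ∀ (b : (𝒯.B p K).Birth) (k' k : ℕ), (𝒯.B p K).birthScale b ≤ k' → k' ≤ k →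
      ∀ x ∈ Sg p K k b, ∀ U₀ ∈ (bondBall d ((W p K).ρw (k + 1)) : Set (Fld d R)), ∀ pd : NDir d R, 0 < latN pd →
        latN pd ≤ (W p K).wc (k + 1) →
        ∀ᵐ z ∂μ p K b k, ∀ t ∈ tube ((W p K).ϱ₁ k / latN pd),
          RelGauge (rel p K x.1 x.2 k) latMove latN (latMove U₀ pd t + z₁ p K b k) (latMove U₀ pd t + z) (δf p K b k x))
    (hinv : ∀ p K, ∀ b k' k, GaugeInvariant (rel p K b k' k) (Fn p K b k' k))
    (hmeas : ∀ p K, ∀ (b f : (𝒯.B p K).Birth) (k'' k : ℕ) (U : Fld d R),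
      AEStronglyMeasurable (fun z => Fn p K f k'' k (U + z)) (μ p K b k))
    (hdefwk : ∀ p K, ∀ (b : (𝒯.B p K).Birth) (k' k : ℕ), defect p K b k' k ≤ (W p K).wc k)
    (hrate : ∀ p K, ∀ (b : (𝒯.B p K).Birth) (k' k : ℕ), (𝒯.B p K).birthScale b ≤ k' → k' ≤ k → k ≤ (𝒯.B p K).K →
      defect p K b k' k ≤ cδ * ((L ^ 2)⁻¹) ^ (k - k'))
    (hlin : ∀ p K, ∀ (b : (𝒯.B p K).Birth) (k' k : ℕ), (𝒯.B p K).birthScale b ≤ k' → k' ≤ k → k ≤ (𝒯.B p K).K →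
      RanBelow (budgetGate (𝒯.T p K) (s p K) m (S p K) (4 * cδ / r)
        (fun i => (L ^ 2)⁻¹ * (fun _ : ℕ => alphaCell κ) i)) k →
      ∀ ε > 0, ∃ U₀ ∈ (bondBall d ((W p K).ρw k) : Set (Fld d R)), ∃ U₁ : Fld d R,
        RelGauge (rel p K b k' k) latMove latN U₀ U₁ (defect p K b k' k) ∧
        (𝒯.T p K).lin b k' k ≤ ‖Fn p K b k' k U₁ - Fn p K b k' k U₀‖ + ε)
    (hc0 : ∀ p K k, 0 ≤ creg p K k) (hcb : ∀ p K k, k < (𝒯.B p K).K → creg p K k ≤ cbar)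
    (hreg : ∀ p K, (𝒯.T p K).RegeneratesFromVar (creg p K)
      (budgetGate (𝒯.T p K) (s p K) m (S p K) (4 * cδ / r) (fun _ : ℕ => (L ^ 2)⁻¹ * alphaCell κ)))
    (hs₀ : ∀ p K, ∀ b k, s p K b k ≤ sbar)
    (hS : ∀ p K, ∀ k b, ∀ f ∈ S p K k b, (𝒯.B p K).birthScale f ≤ k)
    (hcount : ∀ p K, ∀ k b, ∀ j ≤ k,
      (((S p K k b).filter fun f => (𝒯.B p K).birthScale f = j).card : ℝ) ≤ N₀ * (L ^ 4) ^ (k - j))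
    (hbirth : ∀ p K, (𝒯.T p K).BirthsFromOld (4 * cδ / r) (fun _ : ℕ => (L ^ 2)⁻¹ * alphaCell κ)
      (twoRate A₀ (rhoOne (L ^ 2)⁻¹ (4 * cδ / r) cbar κ) (L⁻¹ ^ 3) (𝒯.B p K).K)
      (budgetGate (𝒯.T p K) (s p K) m (S p K) (4 * cδ / r) (fun _ : ℕ => (L ^ 2)⁻¹ * alphaCell κ))) :
    DressedStability 𝒯 := by
  rcases isEmpty_or_nonempty P with hPe | ⟨⟨p₀⟩⟩
  · exact ⟨0, 0, 0, le_rfl, le_rfl, le_rfl, zero_le_one, fun p _ => isEmptyElim p⟩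
  · exact ⟨_, _, _, dressedStabilityWith_swin_of_schedules 𝒯 W hratio hL hcbar
      (κ_nonneg_win (W p₀ 0).toWindowScheduleWin (hratio p₀ 0)) hN₀ hA₀ hm hloc hρ'1 hsmall hr hcδ hsl hFn h𝒢 hB hE hQ hSg
      hs1 hAsz_birth hAsz_step hcm hδf hδfwk hDμ hz₁ hpairx hinv hmeas hdefwk hrate hlin hc0 hcb hreg hs₀ hS hcount hbirth⟩

end AllCutoffs

/-! ## §2 ROOT-B from the same displayed families: the budget at every cube of every cutoff -/

section Budget

variable {P : Type*} (𝒯 : DressedTower P)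
variable {R : Type*} [NormedRing R] [NormedAlgebra ℂ R] [MeasurableSpace R] {d : ℕ}

/-- **ROOT-B — `DressedBudget 𝒯 wt` — FROM THE DISPLAYED ESTIMATE FAMILIES OF THE ASSEMBLED SLICE-WINDOW FACE** [bookkeeping]
(typer R-T35 (i): every all-cutoff face carries both roots): §1's hypotheses VERBATIM plus K-free positional counts of the bookings
`hcountB : (𝒯.B p K).PositionalCount (fun j k => N₀·(L⁴)^{k−j})` and run weights `0 ≤ wt p K j ≤ w̄` give the per-cube budget with
`c_B = w̄·N₀A₀∕(1−ρ′)` at EVERY cube of EVERY cutoff — §1's With-form followed by S3g's `dressedBudget_win_of_cell` BY NAME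
(`DressedRootFam.dressedBudget_of_dressedStabilityWith_strict`, strict product = row S3's located (w7) via `prod_cell`).  NOT proved for
Bałaban's densities; the (TOB-k) currency the (2.18)-type consumers quantify over. [folklore] -/
theorem dressedBudget_swin_of_schedules {κ L cbar N₀ A₀ sbar ρ' r cδ m : ℝ} {w : P → ℕ → ℝ}
    (W : ∀ p K, WindowScheduleModWin r (w p K))
    {Fn : ∀ p K, (𝒯.B p K).Birth → ℕ → ℕ → Fld d R → ℂ}
    {rel : ∀ p K, (𝒯.B p K).Birth → ℕ → ℕ → Fld d R → Fld d R → Prop}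
    {ref : ∀ p K, (𝒯.B p K).Birth → ℕ → Fld d R → Fld d R} {base : ∀ p K, (𝒯.B p K).Birth → ℕ → Fld d R → ℝ}
    {𝒜 𝒬 : ∀ p K, (𝒯.B p K).Birth → ℕ → Fld d R → Fld d R → ℂ} {q : ∀ p K, (𝒯.B p K).Birth → ℕ → Fld d R → ℂ}
    {μ : ∀ p K, (𝒯.B p K).Birth → ℕ → Measure (Fld d R)} {z₀ z₁ : ∀ p K, (𝒯.B p K).Birth → ℕ → Fld d R}
    {defect : ∀ p K, (𝒯.B p K).Birth → ℕ → ℕ → ℝ} {s s1 : ∀ p K, (𝒯.B p K).Birth → ℕ → ℝ}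
    {Asz : ∀ p K, (𝒯.B p K).Birth → ℕ → ℕ → ℝ} {S : ∀ p K, ℕ → (𝒯.B p K).Birth → Finset (𝒯.B p K).Birth}
    {Sg : ∀ p K, ℕ → (𝒯.B p K).Birth → Finset ((𝒯.B p K).Birth × ℕ)} {c : ∀ p K, (𝒯.B p K).Birth → ℕ → ℂ}
    {δf : ∀ p K, (𝒯.B p K).Birth → ℕ → (𝒯.B p K).Birth × ℕ → ℝ} {creg : P → ℕ → ℕ → ℝ}
    -- the ratio family (K-free κ)
    (hratio : ∀ p K k, 2 * (W p K).σ k ≤ κ * (W p K).ϱc k)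
    -- the twelve scalars' signs and row S3's located inequalities — ONCE
    (hL : 1 ≤ L) (hcbar : 0 ≤ cbar) (hκ : 0 ≤ κ) (hN₀ : 0 ≤ N₀) (hA₀ : 0 ≤ A₀) (hm : 0 ≤ m)
    (hloc : locCell L (4 * cδ / r) cbar κ ≤ ρ') (hρ'1 : ρ' < 1)
    (hsmall : m * (N₀ * A₀ * (1 - ρ')⁻¹) ≤ 1 - sbar) (hr : 0 < r) (hcδ : 0 ≤ cδ)
    -- the assembled END's estimate ∕ dictionary families
    (hsl : ∀ p K, ∀ (b : (𝒯.B p K).Birth) (k' : ℕ), (𝒯.B p K).birthScale b ≤ k' → k' ≤ (𝒯.B p K).K →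
      RanBelow (budgetGate (𝒯.T p K) (s p K) m (S p K) (4 * cδ / r)
        (fun i => (L ^ 2)⁻¹ * (fun _ : ℕ => alphaCell κ) i)) k' →
      BirthSlice (Fn p K b k' k') latMove latN (bondBall d ((W p K).ρw k') : Set (Fld d R)) ((W p K).wc k') r
        ((𝒯.T p K).gen b k'))
    (hFn : ∀ p K, ∀ (b : (𝒯.B p K).Birth) (k' k : ℕ), (𝒯.B p K).birthScale b ≤ k' → k' ≤ k → k + 1 ≤ (𝒯.B p K).K →
      RanBelow (budgetGate (𝒯.T p K) (s p K) m (S p K) (4 * cδ / r)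
        (fun i => (L ^ 2)⁻¹ * (fun _ : ℕ => alphaCell κ) i)) (k + 1) →
      ∀ U, Fn p K b k' (k + 1) U =
        wOp (expWeight (base p K b k) (𝒜 p K b k + 𝒬 p K b k)) (μ p K b k) (z₀ p K b k) U
          (fun z => Fn p K b k' k (U + z)))
    (h𝒢 : ∀ p K, ∀ (b : (𝒯.B p K).Birth) (k' k : ℕ), (𝒯.B p K).birthScale b ≤ k' → k' ≤ k → k + 1 ≤ (𝒯.B p K).K →
      RanBelow (budgetGate (𝒯.T p K) (s p K) m (S p K) (4 * cδ / r)
        (fun i => (L ^ 2)⁻¹ * (fun _ : ℕ => alphaCell κ) i)) (k + 1) →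
      ∀ U, (fun z => Fn p K b k' k (U + z)) ∈ BddClass ℂ (μ p K b k))
    (hB : ∀ p K, ∀ (b : (𝒯.B p K).Birth) (k' k : ℕ), (𝒯.B p K).birthScale b ≤ k' → k' ≤ k → k + 1 ≤ (𝒯.B p K).K →
      RanBelow (budgetGate (𝒯.T p K) (s p K) m (S p K) (4 * cδ / r)
        (fun i => (L ^ 2)⁻¹ * (fun _ : ℕ => alphaCell κ) i)) (k + 1) →
      RealBaseAt (ref p K b k) (base p K b k) (𝒜 p K b k) (μ p K b k)
        (bondBall d ((W p K).ρw (k + 1)) : Set (Fld d R)))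
    (hE : ∀ p K, ∀ (b : (𝒯.B p K).Birth) (k' k : ℕ), (𝒯.B p K).birthScale b ≤ k' → k' ≤ k → k + 1 ≤ (𝒯.B p K).K →
      RanBelow (budgetGate (𝒯.T p K) (s p K) m (S p K) (4 * cδ / r)
        (fun i => (L ^ 2)⁻¹ * (fun _ : ℕ => alphaCell κ) i)) (k + 1) →
      ExponentSliceAt (ref p K b k) (𝒜 p K b k) (μ p K b k) latMove latN
        (bondBall d ((W p K).ρw (k + 1)) : Set (Fld d R)) ((W p K).wc (k + 1)) ((W p K).ϱc k) (s p K b k))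
    (hQ : ∀ p K, ∀ b k, (fun U z => 𝒬 p K b k U z - q p K b k U) =
      fun U z => c p K b k * ∑ x ∈ Sg p K k b, (Fn p K x.1 x.2 k (U + z) - Fn p K x.1 x.2 k (U + z₁ p K b k)))
    (hSg : ∀ p K, ∀ k b, ∀ x ∈ Sg p K k b, x.1 ∈ S p K k b ∧ (𝒯.B p K).birthScale x.1 ≤ x.2 ∧ x.2 ≤ k)
    (hs1 : ∀ p K, ∀ b k, s1 p K b k = ‖c p K b k‖ * ∑ x ∈ Sg p K k b,
      (4 / r * stepProd (fun _ : ℕ => alphaCell κ) x.2 k * (𝒯.T p K).gen x.1 x.2) * δf p K b k x)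
    (hAsz_birth : ∀ p K, ∀ f k'', Asz p K f k'' k'' = (𝒯.T p K).gen f k'')
    (hAsz_step : ∀ p K, ∀ f k'' k, (𝒯.B p K).birthScale f ≤ k'' → k'' ≤ k →
      Asz p K f k'' (k + 1) = Real.exp (3 * (s p K f k + s1 p K f k)) * Asz p K f k'' k)
    (hcm : ∀ p K, ∀ b k, ‖c p K b k‖ ≤ m)
    (hδf : ∀ p K, ∀ b k, ∀ x ∈ Sg p K k b, 0 ≤ δf p K b k x ∧ δf p K b k x ≤ cδ * ((L ^ 2)⁻¹) ^ (k - x.2))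
    (hδfwk : ∀ p K, ∀ b k, ∀ x ∈ Sg p K k b, δf p K b k x ≤ (W p K).wc k)
    (hDμ : ∀ p K, ∀ b k, ∀ᵐ z ∂μ p K b k, z ∈ (bondBall d ((W p K).σ k) : Set (Fld d R)))
    (hz₁ : ∀ p K, ∀ b k, z₁ p K b k ∈ (bondBall d ((W p K).σ k) : Set (Fld d R)))
    (hpairx : ∀ p K, ∀ (b : (𝒯.B p K).Birth) (k' k : ℕ), (𝒯.B p K).birthScale b ≤ k' → k' ≤ k →
      ∀ x ∈ Sg p K k b, ∀ U₀ ∈ (bondBall d ((W p K).ρw (k + 1)) : Set (Fld d R)), ∀ pd : NDir d R, 0 < latN pd →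
        latN pd ≤ (W p K).wc (k + 1) →
        ∀ᵐ z ∂μ p K b k, ∀ t ∈ tube ((W p K).ϱ₁ k / latN pd),
          RelGauge (rel p K x.1 x.2 k) latMove latN (latMove U₀ pd t + z₁ p K b k) (latMove U₀ pd t + z) (δf p K b k x))
    (hinv : ∀ p K, ∀ b k' k, GaugeInvariant (rel p K b k' k) (Fn p K b k' k))
    (hmeas : ∀ p K, ∀ (b f : (𝒯.B p K).Birth) (k'' k : ℕ) (U : Fld d R),
      AEStronglyMeasurable (fun z => Fn p K f k'' k (U + z)) (μ p K b k))
    (hdefwk : ∀ p K, ∀ (b : (𝒯.B p K).Birth) (k' k : ℕ), defect p K b k' k ≤ (W p K).wc k)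
    (hrate : ∀ p K, ∀ (b : (𝒯.B p K).Birth) (k' k : ℕ), (𝒯.B p K).birthScale b ≤ k' → k' ≤ k → k ≤ (𝒯.B p K).K →
      defect p K b k' k ≤ cδ * ((L ^ 2)⁻¹) ^ (k - k'))
    (hlin : ∀ p K, ∀ (b : (𝒯.B p K).Birth) (k' k : ℕ), (𝒯.B p K).birthScale b ≤ k' → k' ≤ k → k ≤ (𝒯.B p K).K →
      RanBelow (budgetGate (𝒯.T p K) (s p K) m (S p K) (4 * cδ / r)
        (fun i => (L ^ 2)⁻¹ * (fun _ : ℕ => alphaCell κ) i)) k →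
      ∀ ε > 0, ∃ U₀ ∈ (bondBall d ((W p K).ρw k) : Set (Fld d R)), ∃ U₁ : Fld d R,
        RelGauge (rel p K b k' k) latMove latN U₀ U₁ (defect p K b k' k) ∧
        (𝒯.T p K).lin b k' k ≤ ‖Fn p K b k' k U₁ - Fn p K b k' k U₀‖ + ε)
    -- the booking-level wall families
    (hc0 : ∀ p K k, 0 ≤ creg p K k) (hcb : ∀ p K k, k < (𝒯.B p K).K → creg p K k ≤ cbar)
    (hreg : ∀ p K, (𝒯.T p K).RegeneratesFromVar (creg p K)
      (budgetGate (𝒯.T p K) (s p K) m (S p K) (4 * cδ / r) (fun _ : ℕ => (L ^ 2)⁻¹ * alphaCell κ)))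
    (hs₀ : ∀ p K, ∀ b k, s p K b k ≤ sbar)
    (hS : ∀ p K, ∀ k b, ∀ f ∈ S p K k b, (𝒯.B p K).birthScale f ≤ k)
    (hcount : ∀ p K, ∀ k b, ∀ j ≤ k,
      (((S p K k b).filter fun f => (𝒯.B p K).birthScale f = j).card : ℝ) ≤ N₀ * (L ^ 4) ^ (k - j))
    (hbirth : ∀ p K, (𝒯.T p K).BirthsFromOld (4 * cδ / r) (fun _ : ℕ => (L ^ 2)⁻¹ * alphaCell κ)
      (twoRate A₀ (rhoOne (L ^ 2)⁻¹ (4 * cδ / r) cbar κ) (L⁻¹ ^ 3) (𝒯.B p K).K)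
      (budgetGate (𝒯.T p K) (s p K) m (S p K) (4 * cδ / r) (fun _ : ℕ => (L ^ 2)⁻¹ * alphaCell κ)))
    -- ROOT-B data: run weights and K-free positional counts of the bookings
    {wbar : ℝ} {wt : P → ℕ → ℕ → ℝ} (hwbar : 0 ≤ wbar)
    (hw0 : ∀ p K, ∀ j ≤ K, 0 ≤ wt p K j) (hwb : ∀ p K, ∀ j ≤ K, wt p K j ≤ wbar)
    (hcountB : ∀ p K, (𝒯.B p K).PositionalCount fun j k => N₀ * (L ^ 4) ^ (k - j)) :
    DressedBudget 𝒯 wt :=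
  dressedBudget_win_of_cell
    (dressedStabilityWith_swin_of_schedules 𝒯 W hratio hL hcbar hκ hN₀ hA₀ hm hloc hρ'1 hsmall hr hcδ hsl hFn h𝒢 hB hE hQ hSg
      hs1 hAsz_birth hAsz_step hcm hδf hδfwk hDμ hz₁ hpairx hinv hmeas hdefwk hrate hlin hc0 hcb hreg hs₀ hS hcount hbirth)
    hL hN₀ hloc hρ'1 hwbar hw0 hwb hcountB

end Budget

/-! ## §3 ONE cutoff-free schedule for every `(p, K)` -/

section OneSchedule

variable {P : Type*}

/-- [decided toy] The SINGLE cutoff-free schedule `W p K := WindowScheduleModWin.geometric r w q σ₀ ϱ₀ ρ∞` inhabits §1's ratio family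
with the K-free `κ := 2σ₀∕(ϱ₀q)` for all `(p, K, k)` (part 1 `geometric_mod_ratio_κ`) — so §1 applies with ONE schedule and ONE
`uniformConstantsCell … (2σ₀∕(ϱ₀q)) …` for every cutoff, the (w1) window in `hsl` being the same finite ball at EVERY cutoff. [folklore] -/
theorem hratio_geometric_mod_all {r w q σ₀ ϱ₀ ρinf : ℝ} (hq0 : 0 < q) (hq1 : q < 1) (hσ₀ : 0 < σ₀) (hσ₀w : 2 * σ₀ ≤ w)
    (hϱ₀ : 0 < ϱ₀) (hϱ₀r : ϱ₀ ≤ r) :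
    ∀ (_p : P) (_K k : ℕ),
      2 * ((fun (_ : P) (_ : ℕ) => WindowScheduleModWin.geometric r w q σ₀ ϱ₀ ρinf hq0 hq1 hσ₀ hσ₀w hϱ₀ hϱ₀r) _p _K).σ k ≤
        (2 * σ₀ / (ϱ₀ * q)) *
          ((fun (_ : P) (_ : ℕ) => WindowScheduleModWin.geometric r w q σ₀ ϱ₀ ρinf hq0 hq1 hσ₀ hσ₀w hϱ₀ hϱ₀r) _p _K).ϱc k :=
  fun _ _ k => geometric_mod_ratio_κ hq0 hq1 hσ₀ hσ₀w hϱ₀ hϱ₀r k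

end OneSchedule

end Summit.QuantumFields.BalabanUV.T4Continuum.NE1p.DressedStabilityOfSliceWinSchedules

end
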